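import Summits.Ventures.QEC.CircuitDistance.ETowerSound
import HarnessLib

/-!
# P3-PORT STEP 2 (E-fold tower): soundness of the TOP continuation `ktop` and of the level-`C` node with the weight-3 short-cut
# (ASSEMBLY-SPEC §B6; cell `qec`, experiment CDX, seat qec-cdx-type-1)

The sector K-files (eng-1, idea-1's prototype shape) define
`ktop S := (xorIdx (fun j => tab TLG 12 j) S == 0) || (matchRep 12 6 md0 (repStore md0 TOPS) false S).isSome` and
`nodeC S := (S.length == 3 && (matchRep 6 6 md0 (repStore md0 W3C) false S).isSome) || nodeK GC 180 MC MpC 9 ktop S`.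
Here the same shapes with the data as parameters (`ktopG`, `nodeSpG`) and their soundness: `ktopG_sound` (⇒ `QTop`) and
`nodeSpG_sound` (⇒ `GoodFibK`, the short-cut classes being certified separately, e.g. by windows).  A sector file whose `ktop` /
`nodeC` are literally these shapes instantiates them by `rfl`.  Generic; no data; no `native_decide`.
-/

namespace Summit.Ventures.QEC.CircuitDistance.ETower

open Summit.Ventures.QEC.Census Summit.Ventures.QEC.Census.Fold

/-- The top continuation shape: all logical parities of the word vanish, or an anchored translate is a listed class. -/
noncomputable def ktopG (l m : ℕ) (lgT : ℕ → ℕ) (md : ℕ) (TOPS : List ℕ) (S : List ℕ) : Bool :=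
  (xorIdx lgT S == 0) || (matchRep l m md (repStore md TOPS) false S).isSome

/-- **Soundness of the top continuation**: a passing `ktopG` on a support list inside the window gives `QTop` of its word
(the logical table `lgT` used by the checker agreeing with `lg` on the window). -/
theorem ktopG_sound {l m nb : ℕ} {syn lg lgT : ℕ → ℕ} (hlg : ∀ J, J < nb * (l * m) → lgT J = lg J) {md : ℕ} {TOPS : List ℕ}
    {S : List ℕ} (hS : ∀ J ∈ S, J < nb * (l * m)) (h : ktopG l m lgT md TOPS S = true) :
    QTop l m nb syn lg TOPS (maskOf S) := by
  unfold ktopG at h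
  rw [Bool.or_eq_true] at h
  rcases h with h | h
  · left
    intro _
    rw [beq_iff_eq] at h
    unfold kerK
    rw [← xorIdx_eq_lin _ _ _ hS, ← xorIdx_congr (fun J hJ => hlg J (hS J hJ)), h]
  · rcases matchedK_of_matchRep (nb := nb) hS h with ⟨-, hf⟩ | hM
    · exact absurd hf Bool.false_ne_true
    · exact Or.inr hM

/-- The node shape with a short-cut for listed special words of a given length (certified elsewhere). -/
noncomputable def nodeSpG (G : Geo) (ns : ℕ) (M Mp : ℕ → ℕ) (W : ℕ) (k : List ℕ → Bool) (len md : ℕ) (SPEC : List ℕ)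
    (S : List ℕ) : Bool :=
  (S.length == len && (matchRep G.ls G.ms md (repStore md SPEC) false S).isSome) || nodeK G ns M Mp W k S

/-- **Soundness of the short-cut node**: as `nodeK_sound`, the short-cut classes `SPEC` having the fibre property by other means. -/
theorem nodeSpG_sound {G : Geo} {nb : ℕ} (hS : G.Shape) (hG : OKK G nb) {col : ℕ → ℕ}
    (hK : ∀ da db u, u < 2 ^ nK G nb → (kerK col (nK G nb) u ↔ kerK col (nK G nb) (transWK G.l G.m nb da db u)))
    {M Mp : ℕ → ℕ} (hM : ∀ j, j < nsK G nb → M j = col (G.emb j) ^^^ col (G.partner (G.emb j)))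
    (hMp : ∀ j, j < nsK G nb → Mp j = col (G.partner (G.emb j)))
    {W : ℕ} {k : List ℕ → Bool} {Q : ℕ → Prop} (hQ : ∀ da db u, Q (transWK G.l G.m nb da db u) → Q u)
    (hk : ∀ S', (∀ J ∈ S', J < nK G nb) → S'.length = popc (nK G nb) (maskOf S') → k S' = true → Q (maskOf S'))
    {len md : ℕ} {SPEC : List ℕ} (hSPEC : ∀ r ∈ SPEC, GoodFibK G nb col W Q r)
    {S : List ℕ} (hSb : ∀ j ∈ S, j < nsK G nb) (h : nodeSpG G (nsK G nb) M Mp W k len md SPEC S = true) :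
    GoodFibK G nb col W Q (maskOf S) := by
  unfold nodeSpG at h
  rw [Bool.or_eq_true] at h
  rcases h with h | h
  · rw [Bool.and_eq_true] at h
    rcases matchedK_of_matchRep (nb := nb) hSb h.2 with ⟨-, hf⟩ | hM
    · exact absurd hf Bool.false_ne_true
    · exact goodFibK_of_matched hS hG hK hQ hSPEC hM
  · exact nodeK_sound hS hG (hK G.gen.1 G.gen.2) hM hMp (hQ G.gen.1 G.gen.2) hk hSb h


/-- The node shape with a short-cut under an ARBITRARY Bool guard `g` (eng-1's K files use `decide (S.length ≤ 3)`). -/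
noncomputable def nodeGdG (G : Geo) (ns : ℕ) (M Mp : ℕ → ℕ) (W : ℕ) (k : List ℕ → Bool) (g : List ℕ → Bool) (md : ℕ)
    (SPEC : List ℕ) (S : List ℕ) : Bool :=
  (g S && (matchRep G.ls G.ms md (repStore md SPEC) false S).isSome) || nodeK G ns M Mp W k S

/-- **Soundness of the guarded short-cut node** (any guard): as `nodeSpG_sound`. -/
theorem nodeGdG_sound {G : Geo} {nb : ℕ} (hS : G.Shape) (hG : OKK G nb) {col : ℕ → ℕ}
    (hK : ∀ da db u, u < 2 ^ nK G nb → (kerK col (nK G nb) u ↔ kerK col (nK G nb) (transWK G.l G.m nb da db u)))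
    {M Mp : ℕ → ℕ} (hM : ∀ j, j < nsK G nb → M j = col (G.emb j) ^^^ col (G.partner (G.emb j)))
    (hMp : ∀ j, j < nsK G nb → Mp j = col (G.partner (G.emb j)))
    {W : ℕ} {k : List ℕ → Bool} {Q : ℕ → Prop} (hQ : ∀ da db u, Q (transWK G.l G.m nb da db u) → Q u)
    (hk : ∀ S', (∀ J ∈ S', J < nK G nb) → S'.length = popc (nK G nb) (maskOf S') → k S' = true → Q (maskOf S'))
    {g : List ℕ → Bool} {md : ℕ} {SPEC : List ℕ} (hSPEC : ∀ r ∈ SPEC, GoodFibK G nb col W Q r)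
    {S : List ℕ} (hSb : ∀ j ∈ S, j < nsK G nb) (h : nodeGdG G (nsK G nb) M Mp W k g md SPEC S = true) :
    GoodFibK G nb col W Q (maskOf S) := by
  unfold nodeGdG at h
  rw [Bool.or_eq_true] at h
  rcases h with h | h
  · rw [Bool.and_eq_true] at h
    rcases matchedK_of_matchRep (nb := nb) hSb h.2 with ⟨-, hf⟩ | hM
    · exact absurd hf Bool.false_ne_true
    · exact goodFibK_of_matched hS hG hK hQ hSPEC hM
  · exact nodeK_sound hS hG (hK G.gen.1 G.gen.2) hM hMp (hQ G.gen.1 G.gen.2) hk hSb h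

end Summit.Ventures.QEC.CircuitDistance.ETower
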